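import Mathlib
import Summits.KontsevichZagierPeriods.Zeta5Search.BigPrimeNineWindowSharp
import HarnessLib.Audit
import HarnessLib

/-!
# `F̃₉(b)`: the END CONGRUENCE — just past the big-prime window, `K_u ≡ 2 (mod p)`

Cell `pub-zeta5` (HONEST FRAMING: systematic search; no irrationality claim unless certified).  Provenance: written
by the family-designer seat `pub-zeta5-fam-vwp-g13` (planner role, no stage permission; staged for the cell's lane).
OUR theorems (Summit side; coefficient arithmetic only, no irrationality content).

`BigPrimeNineWindowSharp` proved that at the first prime(-multiple) past the window, `u·p = d₉ + 3` (`u = 1, 2, 3` for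
`K₃, K₅, K₇`), the coefficient `K_u` of `F̃₉(b) = 2K₃ζ(3) + 2K₅ζ(5) + 2K₇ζ(7) − K₀` is a `p`-adic UNIT (slot regime
`b₀ + 1 ≤ p + b_{j₂} + b_{j₃}`, thresholds `p ≥ 7/5/5`).  The same computation gives its RESIDUE: the cleared numerator is
`≡ U' · Σ_{x∈𝔽_p}[X^r] M2(X + x) = U' · (−(−1)^r · lc M2) = 2U'` (`r = 7, 5, 3` odd, `lc M2 = 2`; at the two critical tops
the sum is `lc M2 = 2` directly), so

* **`padicNorm_coeff3_sub_two_le_of_slots`** (`p ≥ 7`, `p = d₉ + 3`), **`padicNorm_coeff5_sub_two_le_of_slots`**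
  (`p ≥ 5`, `2p = d₉ + 3`), **`padicNorm_coeff7_sub_two_le_of_slots`** (`p ≥ 5`, `3p = d₉ + 3`):
  `‖K_u − 2‖_p ≤ p⁻¹`, i.e. **`K_u ≡ 2 (mod p)`** — on both sides of `b₀`.  (The `k = 7` analogue above `b₀` is the tree's
  `BigPrime.padicNorm_coeffW/U_sub_two_le` of `BigPrimeCongruence`, below `b₀` at one level `BigPrimeBelowB0Sharp…_of_slot`.)
* `padicNorm_coeff3/5/7_sub_two_le`: the slot-free form above `b₀` (`p ≥ b₀ + 1`; slots `j₁ = 0`, `j₂ = j₃` a minimiser).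

Observed first (`g13/cong_scan.py`: every end instance with `b₀ ≤ 11`, `2,669` of them, has `K_u mod p = 2`), then read
off the proof of `BigPrimeNineWindowSharp`.  `padicNorm_sub_two_le` is the generic step
(`U·w = Z`, `p ∤ U`, `p ∣ Z − 2U` ⟹ `‖w − 2‖_p ≤ p⁻¹`).
-/

noncomputable section

open Finset Polynomial

namespace Summit.KontsevichZagierPeriods.Zeta5Search.BigPrimeNine

open Summit.KontsevichZagierPeriods.Zeta5Search.DualSeriesNine (InBox coeff3 coeff5 coeff7 coeff3_eq coeff5_eq coeff7_eq
  exists_isPFData9 IsPFData9)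
open Summit.KontsevichZagierPeriods.Zeta5Search.DualSeriesNineMinors (dNine)
open Summit.KontsevichZagierPeriods.Zeta5Search.BigPrime (block sum_taylor_coeff_top)

/-- Generic step: `U · w = Z` in `ℚ` with `p ∤ U` and `p ∣ Z − 2U` ⟹ `‖w − 2‖_p ≤ p⁻¹` (`w ≡ 2 (mod p)` as a `p`-adic
integer; this also covers `w = 2`, where `‖0‖_p = 0`).  Same shape as the tree's `k = 7` proof in `BigPrimeCongruence`. -/
theorem padicNorm_sub_two_le {p : ℕ} [hp : Fact p.Prime] {U Z : ℤ} {w : ℚ} (hUw : (U : ℚ) * w = Z)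
    (hU : ¬ (p : ℤ) ∣ U) (hZ : (p : ℤ) ∣ Z - 2 * U) : padicNorm p (w - 2) ≤ (p : ℚ)⁻¹ := by
  have hU0 : U ≠ 0 := fun h => hU (by rw [h]; exact dvd_zero _)
  have hw : w - 2 = ((Z - 2 * U : ℤ) : ℚ) / U := by
    rw [eq_div_iff (by exact_mod_cast hU0)]
    push_cast
    linear_combination hUw
  rw [hw, padicNorm.div, (padicNorm.int_eq_one_iff _).2 hU, div_one, ← zpow_neg_one]
  exact (padicNorm.dvd_iff_norm_le (n := 1)).1 (by simpa using hZ)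

section EndCongruence

variable {p : ℕ}

/-- **END CONGRUENCE for `K₃`** (slot regime): slots `j₁` (dropped), `j₂ ≠ j₁`, `j₃` with `b_{j₂} ≤ b_{j₃} ≤ b_j`
(`j ∉ {j₁, j₂}`), `p` prime, `p ≥ 7`, `b₀ + 1 ≤ p + b_{j₂} + b_{j₃}`, `p = d₉(b) + 3` ⟹ `‖coeff3 b − 2‖_p ≤ p⁻¹`,
i.e. `K₃ ≡ 2 (mod p)`.  (At `p = 7` the read index is critical and `sum_taylor_coeff_card_top` is used.) -/
theorem padicNorm_coeff3_sub_two_le_of_slots (b : ℕ → ℤ) (p j₁ j₂ j₃ : ℕ) (hb : InBox b)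
    (h2 : ∀ i ∈ range 9, 2 * b (i + 1) ≤ b 0) (hj₁ : j₁ ∈ range 9) (hj₂ : j₂ ∈ range 9) (hj₃ : j₃ ∈ range 9)
    (h12 : j₂ ≠ j₁) (hle : b (j₂ + 1) ≤ b (j₃ + 1))
    (hmin : ∀ j ∈ range 9, j ≠ j₁ → j ≠ j₂ → b (j₃ + 1) ≤ b (j + 1)) (hprime : p.Prime) (hp7 : 7 ≤ p)
    (hpT : b 0 + 1 ≤ (p : ℤ) + b (j₂ + 1) + b (j₃ + 1)) (hpd : (p : ℤ) = dNine b + 3) :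
    padicNorm p (coeff3 b - 2) ≤ (p : ℚ)⁻¹ := by
  haveI : Fact p.Prime := ⟨hprime⟩
  obtain ⟨e0, hS, hβ⟩ := polytope_data b hb h2
  obtain ⟨hj₂', h23, hmin', hT', hS', h3'⟩ := slot_data b hb h2 hj₂ hj₃ h12 hle hmin hpT
  have hpd' : p + ∑ j ∈ range 9, (b (j + 1)).toNat = 4 * (b 0).toNat + 3 := by
    have := hpd; rw [dNine, hS, e0] at this; omega
  have hsum : ∑ i ∈ range 9, b (i + 1) ≤ 4 * b 0 + 2 := by
    have := hpd; rw [dNine] at this; omega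
  have hhalf : ∀ j ∈ range 9, 2 * b (j + 1) ≤ b 0 + 1 := fun j hj => by have := h2 j hj; omega
  obtain ⟨c, hc⟩ := exists_isPFData9 b hb hsum
  have hUK := U2all_mul_sum_eq b hb hhalf hc hj₁ hj₂' h23 hmin' (o := 2) (by norm_num) (by norm_num)
  rw [← coeff3_eq hc] at hUK
  refine padicNorm_sub_two_le hUK (not_dvd_U2all hprime hT' h23) ?_
  have hdeg : (M2 p (b 0).toNat (fun j => (b (j + 1)).toNat) j₁ j₂ j₃).natDegree = 8 * p - 1 := by
    have := natDegree_M2_eq (p := p) (by omega) hj₁ hj₂' hS' hT' h23 hmin' hβ h3'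
    beta_reduce at this
    omega
  rw [← ZMod.intCast_zmod_eq_zero_iff_dvd]
  push_cast
  rw [Z2sum_cast hj₁ hj₂' hS' hT' h23 h3' hmin' (by norm_num : 5 < 6) (by omega)]
  rcases (show p = 7 ∨ 7 < p by omega) with rfl | hlt
  · rw [sum_taylor_coeff_card_top (by norm_num) _
        (X_pow_card_sub_X_sq_dvd_M2 hj₁ hj₂' hT' h23 h3' hmin') (by omega), leadingCoeff_M2 (by norm_num)]
    ring
  · rw [sum_taylor_coeff_top _ 7 hlt (by omega), leadingCoeff_M2 (by omega)]
    ring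

/-- **END CONGRUENCE for `K₅`** (slot regime): same slots, `p ≥ 5`, `b₀ + 1 ≤ p + b_{j₂} + b_{j₃}`, `2p = d₉(b) + 3`
⟹ `‖coeff5 b − 2‖_p ≤ p⁻¹`, i.e. `K₅ ≡ 2 (mod p)` (at `p = 5` the read index is critical). -/
theorem padicNorm_coeff5_sub_two_le_of_slots (b : ℕ → ℤ) (p j₁ j₂ j₃ : ℕ) (hb : InBox b)
    (h2 : ∀ i ∈ range 9, 2 * b (i + 1) ≤ b 0) (hj₁ : j₁ ∈ range 9) (hj₂ : j₂ ∈ range 9) (hj₃ : j₃ ∈ range 9)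
    (h12 : j₂ ≠ j₁) (hle : b (j₂ + 1) ≤ b (j₃ + 1))
    (hmin : ∀ j ∈ range 9, j ≠ j₁ → j ≠ j₂ → b (j₃ + 1) ≤ b (j + 1)) (hprime : p.Prime) (hp5 : 5 ≤ p)
    (hpT : b 0 + 1 ≤ (p : ℤ) + b (j₂ + 1) + b (j₃ + 1)) (hpd : 2 * (p : ℤ) = dNine b + 3) :
    padicNorm p (coeff5 b - 2) ≤ (p : ℚ)⁻¹ := by
  haveI : Fact p.Prime := ⟨hprime⟩
  obtain ⟨e0, hS, hβ⟩ := polytope_data b hb h2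
  obtain ⟨hj₂', h23, hmin', hT', hS', h3'⟩ := slot_data b hb h2 hj₂ hj₃ h12 hle hmin hpT
  have hpd' : 2 * p + ∑ j ∈ range 9, (b (j + 1)).toNat = 4 * (b 0).toNat + 3 := by
    have := hpd; rw [dNine, hS, e0] at this; omega
  have hsum : ∑ i ∈ range 9, b (i + 1) ≤ 4 * b 0 + 2 := by
    have := hpd; rw [dNine] at this; omega
  have hhalf : ∀ j ∈ range 9, 2 * b (j + 1) ≤ b 0 + 1 := fun j hj => by have := h2 j hj; omega
  obtain ⟨c, hc⟩ := exists_isPFData9 b hb hsum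
  have hUK := U2all_mul_sum_eq b hb hhalf hc hj₁ hj₂' h23 hmin' (o := 4) (by norm_num) (by norm_num)
  rw [← coeff5_eq hc] at hUK
  refine padicNorm_sub_two_le hUK (not_dvd_U2all hprime hT' h23) ?_
  have hdeg : (M2 p (b 0).toNat (fun j => (b (j + 1)).toNat) j₁ j₂ j₃).natDegree = 6 * p - 1 := by
    have := natDegree_M2_eq (p := p) (by omega) hj₁ hj₂' hS' hT' h23 hmin' hβ h3'
    beta_reduce at this
    omega
  rw [← ZMod.intCast_zmod_eq_zero_iff_dvd]
  push_cast
  rw [Z2sum_cast hj₁ hj₂' hS' hT' h23 h3' hmin' (by norm_num : 3 < 6) (by omega)]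
  rcases (show p = 5 ∨ 5 < p by omega) with rfl | hlt
  · rw [sum_taylor_coeff_card_top (by norm_num) _
        (X_pow_card_sub_X_sq_dvd_M2 hj₁ hj₂' hT' h23 h3' hmin') (by omega), leadingCoeff_M2 (by norm_num)]
    ring
  · rw [sum_taylor_coeff_top _ 5 hlt (by omega), leadingCoeff_M2 (by omega)]
    ring

/-- **END CONGRUENCE for `K₇`** (slot regime): same slots, `p ≥ 5`, `b₀ + 1 ≤ p + b_{j₂} + b_{j₃}`, `3p = d₉(b) + 3`
⟹ `‖coeff7 b − 2‖_p ≤ p⁻¹`, i.e. `K₇ ≡ 2 (mod p)` (read index `3 < p`). -/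
theorem padicNorm_coeff7_sub_two_le_of_slots (b : ℕ → ℤ) (p j₁ j₂ j₃ : ℕ) (hb : InBox b)
    (h2 : ∀ i ∈ range 9, 2 * b (i + 1) ≤ b 0) (hj₁ : j₁ ∈ range 9) (hj₂ : j₂ ∈ range 9) (hj₃ : j₃ ∈ range 9)
    (h12 : j₂ ≠ j₁) (hle : b (j₂ + 1) ≤ b (j₃ + 1))
    (hmin : ∀ j ∈ range 9, j ≠ j₁ → j ≠ j₂ → b (j₃ + 1) ≤ b (j + 1)) (hprime : p.Prime) (hp5 : 5 ≤ p)
    (hpT : b 0 + 1 ≤ (p : ℤ) + b (j₂ + 1) + b (j₃ + 1)) (hpd : 3 * (p : ℤ) = dNine b + 3) :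
    padicNorm p (coeff7 b - 2) ≤ (p : ℚ)⁻¹ := by
  haveI : Fact p.Prime := ⟨hprime⟩
  obtain ⟨e0, hS, hβ⟩ := polytope_data b hb h2
  obtain ⟨hj₂', h23, hmin', hT', hS', h3'⟩ := slot_data b hb h2 hj₂ hj₃ h12 hle hmin hpT
  have hpd' : 3 * p + ∑ j ∈ range 9, (b (j + 1)).toNat = 4 * (b 0).toNat + 3 := by
    have := hpd; rw [dNine, hS, e0] at this; omega
  have hsum : ∑ i ∈ range 9, b (i + 1) ≤ 4 * b 0 + 2 := by
    have := hpd; rw [dNine] at this; omega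
  have hhalf : ∀ j ∈ range 9, 2 * b (j + 1) ≤ b 0 + 1 := fun j hj => by have := h2 j hj; omega
  obtain ⟨c, hc⟩ := exists_isPFData9 b hb hsum
  have hUK := U2all_mul_sum_eq b hb hhalf hc hj₁ hj₂' h23 hmin' (o := 6) (by norm_num) (by norm_num)
  rw [← coeff7_eq hc] at hUK
  refine padicNorm_sub_two_le hUK (not_dvd_U2all hprime hT' h23) ?_
  have hdeg : (M2 p (b 0).toNat (fun j => (b (j + 1)).toNat) j₁ j₂ j₃).natDegree = 3 + (3 + 1) * (p - 1) := by
    have := natDegree_M2_eq (p := p) (by omega) hj₁ hj₂' hS' hT' h23 hmin' hβ h3'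
    beta_reduce at this
    omega
  rw [← ZMod.intCast_zmod_eq_zero_iff_dvd]
  push_cast
  rw [Z2sum_cast hj₁ hj₂' hS' hT' h23 h3' hmin' (by norm_num : 1 < 6) (by omega),
    sum_taylor_coeff_top _ 3 (by omega) hdeg, leadingCoeff_M2 (by omega)]
  ring

end EndCongruence

section AboveB0

/-! Above `b₀` no slot bookkeeping is needed (`p ≥ b₀ + 1` lies in every slot window): take `j₁ = 0` and `j₂ = j₃` a
minimiser of `b` on the other eight blocks.  These complement `BigPrimeNineSharp.padicValRat_coeff*_eq_zero_of_eq_dNine_add_three`. -/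

/-- A minimiser of `b` over the blocks `1, …, 9` (FILING-LANE edit, P2 g4: docstring added for the gate's docstring lint). -/
private theorem exists_slot_min (b : ℕ → ℤ) :
    ∃ j ∈ range 9, j ≠ 0 ∧ ∀ i ∈ range 9, i ≠ 0 → b (j + 1) ≤ b (i + 1) := by
  obtain ⟨j, hj, hjmin⟩ := ((range 9).erase 0).exists_min_image (fun j => b (j + 1)) ⟨1, by simp⟩
  exact ⟨j, mem_of_mem_erase hj, ne_of_mem_erase hj, fun i hi hi0 => hjmin i (mem_erase.2 ⟨hi0, hi⟩)⟩

/-- **END CONGRUENCE for `K₃` above `b₀`**: `p` prime, `p ≥ 7`, `p ≥ b₀ + 1`, `p = d₉(b) + 3` ⟹ `K₃ ≡ 2 (mod p)`. -/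
theorem padicNorm_coeff3_sub_two_le (b : ℕ → ℤ) (p : ℕ) (hb : InBox b) (h2 : ∀ i ∈ range 9, 2 * b (i + 1) ≤ b 0)
    (hprime : p.Prime) (hp7 : 7 ≤ p) (hpb : b 0 + 1 ≤ (p : ℤ)) (hpd : (p : ℤ) = dNine b + 3) :
    padicNorm p (coeff3 b - 2) ≤ (p : ℚ)⁻¹ := by
  obtain ⟨j, hj, hj0, hjmin⟩ := exists_slot_min b
  have h0 := (hb.2 j hj).1
  exact padicNorm_coeff3_sub_two_le_of_slots b p 0 j j hb h2 (by simp) hj hj hj0 le_rfl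
    (fun i hi hi0 _ => hjmin i hi hi0) hprime hp7 (by omega) hpd

/-- **END CONGRUENCE for `K₅` above `b₀`**: `p` prime, `p ≥ 5`, `p ≥ b₀ + 1`, `2p = d₉(b) + 3` ⟹ `K₅ ≡ 2 (mod p)`. -/
theorem padicNorm_coeff5_sub_two_le (b : ℕ → ℤ) (p : ℕ) (hb : InBox b) (h2 : ∀ i ∈ range 9, 2 * b (i + 1) ≤ b 0)
    (hprime : p.Prime) (hp5 : 5 ≤ p) (hpb : b 0 + 1 ≤ (p : ℤ)) (hpd : 2 * (p : ℤ) = dNine b + 3) :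
    padicNorm p (coeff5 b - 2) ≤ (p : ℚ)⁻¹ := by
  obtain ⟨j, hj, hj0, hjmin⟩ := exists_slot_min b
  have h0 := (hb.2 j hj).1
  exact padicNorm_coeff5_sub_two_le_of_slots b p 0 j j hb h2 (by simp) hj hj hj0 le_rfl
    (fun i hi hi0 _ => hjmin i hi hi0) hprime hp5 (by omega) hpd

/-- **END CONGRUENCE for `K₇` above `b₀`**: `p` prime, `p ≥ 5`, `p ≥ b₀ + 1`, `3p = d₉(b) + 3` ⟹ `K₇ ≡ 2 (mod p)`. -/
theorem padicNorm_coeff7_sub_two_le (b : ℕ → ℤ) (p : ℕ) (hb : InBox b) (h2 : ∀ i ∈ range 9, 2 * b (i + 1) ≤ b 0)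
    (hprime : p.Prime) (hp5 : 5 ≤ p) (hpb : b 0 + 1 ≤ (p : ℤ)) (hpd : 3 * (p : ℤ) = dNine b + 3) :
    padicNorm p (coeff7 b - 2) ≤ (p : ℚ)⁻¹ := by
  obtain ⟨j, hj, hj0, hjmin⟩ := exists_slot_min b
  have h0 := (hb.2 j hj).1
  exact padicNorm_coeff7_sub_two_le_of_slots b p 0 j j hb h2 (by simp) hj hj hj0 le_rfl
    (fun i hi hi0 _ => hjmin i hi hi0) hprime hp5 (by omega) hpd

end AboveB0

/-- Instances (all three on or below `b₀`, inside the scanned range; exact values from `g13/vwpB.py`):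
`(7;3⁸,0)`: `p = 7 = d₉ + 3`, `K₃ mod 7 = 2`; `(5;2⁵,1³,0)`: `2·5 = d₉ + 3`, `K₅ mod 5 = 2`; `(6;2⁴,1⁴,0)`:
`3·5 = d₉ + 3`, `K₇ mod 5 = 2`. -/
example : (4 : ℤ) * 7 - 24 + 3 = 7 ∧ (4 : ℤ) * 5 - 13 + 3 = 2 * 5 ∧ (4 : ℤ) * 6 - 12 + 3 = 3 * 5 := by norm_num

end Summit.KontsevichZagierPeriods.Zeta5Search.BigPrimeNine

end
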